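import Summits.QuantumFields.YangMills.Theorems.PoincareLipschitzLogCutoffCapacity
import Summits.QuantumFields.YangMills.Theorems.PoincareLipschitzLeungXinTwistedSharp
import HarnessLib

/-!
# Crux `HistoryTailL` (stmt-QuantumFields-19936), K2 organ `hImproveCore` (FROZEN v1 7446c95a; display v3 `hImproveCoreFlat` bac8eda3 via ✓K-5):
# ★★★ THE LOG-CUTOFF STABILITY CAP ON `ℤ³` — for a twisted Leung–Xin-minimal `S³`-valued lattice map, EVERY window `[R∕C₁(c), R]` contains a
# scale `k` with box energy `E_k ≤ c·k`, for every `c > 18`, with NO energy hypothesis — the «bounded ⇒ 3π» half of Schoen–Uhlenbeck's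
# `d(3) = 3` test, by kernel on the lattice (cube constant `3·6 = 18`)

Cell `ym3-torus` (YM ladder rung R3 = continuum SU(2) Yang–Mills on the three-torus — a RUNG, NOT the Clay problem: not d = 4, not infinite
volume, not a mass gap), WIDTH seat `ym-ust-19936-w3` gen 14; `--supports stmt-QuantumFields-19936 --as helper`; THEOREMS ONLY, definition-free.
Imports ✓`…LogCutoffCapacity` (capacity, Abel, harmonic letters) and ✓p699088 `…LeungXinTwistedSharp` (★w8-19936 g6's sharp twisted stability
inequality `twisted_graph_stability_eps`).

WHY.  The K2 organ of record (`hImproveCore` v1, LEAD ★w1-19936 g9; K-4 ✓p709961 `hImprove ⟸ hImproveCore`, K-5 ✓p709591 `hImproveCore ⟸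
hImproveCoreFlat`) asks: bounded normalised energy `E_τ(Q_R) ≤ Λ₀R` ⟹ normalised energy `≤ ε₁` at ONE comparable scale.  Schoen–Uhlenbeck's proof
has two halves: (bounded ⇒ universally capped) by the stability inequality with the log cutoff, and (capped ⇒ small) by the tangent-map gap ∕
compactness.  THIS FILE proves the first half on `ℤ³`, from minimality ALONE: under the twisted Leung–Xin minimality on a finite bond set `T` for
non-negative cutoffs supported in `Q_{2M}(z)` (the organ's local-minimality row supplies it — sequel `…ImproveCoreOfCapped`) and normalised-small twists
`Σ_{T-bonds from Q_{2M}}‖S_b − 1‖_F² ≤ r`, for every `c > 18` and `M ≥ C₁(c)·r` there is `k ∈ [r, M)` with `E_k ≤ c·k`.  Hence the organ's `∀Λ₀`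
is REMOVABLE (the K2 residue is the parameter-free statement «`φ ≤ 19` ⇒ `φ ≤ ε₁` at a comparable scale»), and ✓[A]'s cap `≈ 2304` at every scale
(✓`twisted_stability_caccioppoli_box_half`) sharpens to `18 + o(1)` at one scale per window.  Located (★w3 g14 08:36:48Z): the FLAT organ's slack row
`δ(ρ+1)` admits no such second-variation argument (the ±t comparison leaves an error `≍ ρ√δ`), so stability-road suppliers target `hImproveCore`.

PROOF.  `ε := 2(c−18)∕c` (`2 − ε∕2 = (c+18)∕c`); `η := f∘N` (✓`exists_logProfile`, ✓`exists_supIndex`); ✓`twisted_graph_stability_eps` on `↥T`;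
LEFT `≥ (2−ε∕2)·Σ_k (r∕k − r∕(k+1))E_k` (✓`sum_box_energy_le_sum_profile`); gradient RIGHT `≤ 6·(6r(H+2) + 96r)` (`c_b ≤ 1`, bonds not issuing from
`Q_{2M}` carry `η ≡ 0`, ✓`sum_sq_sub_profile_le`); twist RIGHT `≤ (2 + 8∕ε)·r` (✓`four_sub_trace_eq_half_frob`, ✓`normSq_mulVec_sub_le_frob`, `ηη ≤ 1`);
if every `E_k > ck` on `[r,M)` then `c·r·H < Σ_k …` strictly (`H = Σ_{k∈[r,M)} 1∕(k+1)`), and ✓`cap_arith` gives `H < (650 + 8∕ε)∕(c−18) =: H₀`, against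
`H ≥ H₀` from `M ≥ 2e^{H₀}r` (✓`le_harmonic_of_window`).  `C₁(c) := 2·exp((650 + 8∕ε)∕(c − 18))`.

WHAT (ns `…Theorems.PoincareLipschitzLogCutoffStabilityCap`): ★★★`exists_scale_energy_le`.
HONEST SCOPE.  A theorem about lattice maps under a minimality HYPOTHESIS; nothing of `hImproveCore(Flat)` (the capped ⇒ small half = the gap ∕
compactness half, NOT in print on `ℤ³`), `hImprove`, K1-exp, `MeanDeviationL`, `BlockLipschitzL`, `HistoryTailL` or any summit statement is proved.
YM₃ on T³ is rung R3, NOT the Clay problem; no continuum limit, no mass gap.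

References: R. Schoen, K. Uhlenbeck, Invent. Math. **78** (1984) 89–100 [SchoenUhlenbeck1984] §2 (stability + log cutoff ⇒ `d(3) = 3`); Y. L. Xin,
Duke Math. J. **47** (1980) 609–613 [Xin1980]; T. Kajigaya, Ann. Mat. Pura Appl. (2023) Thm 1.2 (graph stability); T. Bałaban, Commun. Math. Phys. **98**
(1985) 17–51 [Balaban1985Averaging] §3 (the lattice letters' provenance).
-/

set_option autoImplicit false

open scoped BigOperators
open Finset Matrix

namespace Summit.QuantumFields.YangMills.Theorems.PoincareLipschitzLogCutoffStabilityCap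

open Literature.MathematicalPhysics.QuantumFieldTheory.Balaban1983to89.B4Eq19LatticeOperators
  (Zd unitVec box mem_box box_mono card_box add_unitVec_mem_box sub_unitVec_mem_box unitVec_apply_self unitVec_apply_ne)
open Summit.QuantumFields.YangMills.Theorems.PoincareLipschitzLeungXinTwistedIdentity (four_sub_trace_eq_half_frob normSq_mulVec_sub_le_frob)
open Summit.QuantumFields.YangMills.Theorems.PoincareLipschitzLeungXinTwistedGraphStability (transpose_mulVec_dot)
open Summit.QuantumFields.YangMills.Theorems.PoincareLipschitzLeungXinTwistedSharp (twisted_graph_stability_eps)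
open Summit.QuantumFields.YangMills.Theorems.PoincareLipschitzLeungXinBoxCaccioppoli (dot_le_one)
open Summit.QuantumFields.YangMills.Theorems.PoincareLipschitzLogCutoffLetters (exists_supIndex supIndex_step exists_logProfile)
open Summit.QuantumFields.YangMills.Theorems.PoincareLipschitzLogCutoffCapacity
  (sum_sq_sub_profile_le sum_box_energy_le_sum_profile le_harmonic_of_window cap_arith)

/-! ## §1 The stability cap: one good scale per window, from minimality alone -/

set_option maxHeartbeats 400000 in
/-- ★★★ **THE LOG-CUTOFF STABILITY CAP ON `ℤ³` — ONE GOOD SCALE PER WINDOW, NO ENERGY HYPOTHESIS.**  Let `u : ℤ³ → S³ ⊂ ℝ⁴`, bond twists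
`S_b` (orthogonal, acting on the target end by `(S_b)ᵀ`), and suppose the twisted bond correlation over a finite bond set `T` is not increased by
any Leung–Xin variation with a NON-NEGATIVE cutoff supported in `Q_{2M}(z)` (★`twisted_graph_stability_eps`'s minimality), and the twists of
the `T`-bonds issuing from `Q_{2M}(z)` are small in the normalised sense `Σ‖S_b − 1‖_F² ≤ r`.  Then for every `c > 18` there is `C₁(c)`
(here `2·exp((650 + 8∕ε)∕(c−18))`, `ε = 2(c−18)∕c`) such that `C₁·r ≤ M` forces a scale `k ∈ [r, M)` whose box energy
`E_k = Σ_{b ∈ T, both ends in Q_k(z)} |u_x − (S_b)ᵀu_y|²` is at most `c·k`.  Proof: the sharp twisted stability inequality with the sup-norm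
LOG PROFILE `η = f∘N` (§2), Abel summation `Σ_k r·E_k∕(k(k+1)) ≤ Σ ηη·e` (§4), the capacity `6r(H+2) + 96r` (§3) against `c·r·H`, and
`H ≥ log` (§5) — the cube-lattice form of Schoen–Uhlenbeck's «stability caps the log-averaged normalised energy at `k∕(k−2)·(capacity)`»
(`3·6 = 18`; round spheres would give `3π`).  By ✓[A] the cap `≈ 2304` held at EVERY scale; the sharp `18 + o(1)` holds at ONE scale per
`C₁`-window, which is what the K2 organ consumes (its energy row is this conclusion). [cite: SchoenUhlenbeck1984, §2; Xin1980, p.609–613] [folklore] -/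
theorem exists_scale_energy_le {c : ℝ} (hc : 18 < c) : ∃ C₁ : ℝ, 1 ≤ C₁ ∧
    ∀ (T : Finset (Zd 3 × Fin 3)) (u : Zd 3 → Fin 4 → ℝ) (S : Zd 3 × Fin 3 → Matrix (Fin 4) (Fin 4) ℝ) (z : Zd 3) (r M : ℕ),
      (∀ x, dotProduct (u x) (u x) = 1) → (∀ b ∈ T, S b * (S b)ᵀ = 1) → 1 ≤ r → C₁ * r ≤ M →
      (∑ b ∈ T.filter (fun b => b.1 ∈ box z (2 * (M : ℤ))),
          ∑ a : Fin 4, ∑ i : Fin 4, (S b a i - (1 : Matrix (Fin 4) (Fin 4) ℝ) a i) ^ 2 ≤ r) →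
      (∀ η : Zd 3 → ℝ, (∀ y ∉ box z (2 * (M : ℤ)), η y = 0) → (∀ y, 0 ≤ η y) → ∀ (a : Fin 4) (t : ℝ),
        ∑ b ∈ T, dotProduct
          ((Real.sqrt (1 + t ^ 2 * dotProduct (η b.1 • (Pi.single a 1 - dotProduct (Pi.single a 1) (u b.1) • u b.1))
              (η b.1 • (Pi.single a 1 - dotProduct (Pi.single a 1) (u b.1) • u b.1))))⁻¹ •
            (u b.1 + t • (η b.1 • (Pi.single a 1 - dotProduct (Pi.single a 1) (u b.1) • u b.1))))
          ((S b)ᵀ *ᵥ ((Real.sqrt (1 + t ^ 2 * dotProduct (η (b.1 + unitVec b.2) •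
                (Pi.single a 1 - dotProduct (Pi.single a 1) (u (b.1 + unitVec b.2)) • u (b.1 + unitVec b.2)))
              (η (b.1 + unitVec b.2) • (Pi.single a 1 - dotProduct (Pi.single a 1) (u (b.1 + unitVec b.2)) • u (b.1 + unitVec b.2)))))⁻¹ •
            (u (b.1 + unitVec b.2) + t • (η (b.1 + unitVec b.2) •
              (Pi.single a 1 - dotProduct (Pi.single a 1) (u (b.1 + unitVec b.2)) • u (b.1 + unitVec b.2)))))) ≤
        ∑ b ∈ T, dotProduct (u b.1) ((S b)ᵀ *ᵥ u (b.1 + unitVec b.2))) →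
      ∃ k : ℕ, r ≤ k ∧ k < M ∧
        ∑ b ∈ T.filter (fun b => b.1 ∈ box z (k : ℤ) ∧ b.1 + unitVec b.2 ∈ box z (k : ℤ)),
          dotProduct (u b.1 - (S b)ᵀ *ᵥ u (b.1 + unitVec b.2)) (u b.1 - (S b)ᵀ *ᵥ u (b.1 + unitVec b.2)) ≤ c * k := by
  have hc0 : 0 < c := by linarith
  have hc18 : 0 < c - 18 := by linarith
  set ε : ℝ := 2 * (c - 18) / c with hε
  have hε0 : 0 < ε := div_pos (by linarith) hc0
  have hκ : 2 - ε / 2 = (c + 18) / c := by rw [hε]; field_simp; ring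
  have hκ0 : 0 ≤ 2 - ε / 2 := by rw [hκ]; positivity
  set H₀ : ℝ := (650 + 8 / ε) / (c - 18) with hH₀
  have hH₀0 : 0 ≤ H₀ := div_nonneg (by positivity) hc18.le
  have hexp1 : 1 ≤ Real.exp H₀ := Real.one_le_exp hH₀0
  refine ⟨2 * Real.exp H₀, by linarith, ?_⟩
  intro T u S z r M hu hS hr hM hF hmin
  classical
  have hr0 : (0 : ℝ) < r := by exact_mod_cast hr
  have hr1 : (1 : ℝ) ≤ r := by exact_mod_cast hr
  have hrM : r < M := by
    have : (r : ℝ) < M := by nlinarith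
    exact_mod_cast this
  have h2M : ((2 * M : ℕ) : ℤ) = 2 * (M : ℤ) := by push_cast; ring
  -- the shell index and the profile
  obtain ⟨N, hN⟩ := exists_supIndex z
  obtain ⟨f, hf0, hf1, hanti, hzero, hone, hsq, hlogInc, htapInc⟩ := exists_logProfile r M hr hrM.le
  set η : Zd 3 → ℝ := fun y => f (N y) with hη
  have hη0 : ∀ y, 0 ≤ η y := fun y => hf0 _
  have hη1 : ∀ y, η y ≤ 1 := fun y => hf1 _
  have hNout : ∀ y, y ∉ box z (2 * (M : ℤ)) → 2 * M + 1 ≤ N y := by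
    intro y hy
    rw [← h2M, hN] at hy
    omega
  have hηout : ∀ y ∉ box z (2 * (M : ℤ)), η y = 0 := fun y hy => hzero _ (by have := hNout y hy; omega)
  -- ★ the sharp twisted stability inequality on the finite graph `T` with the cutoff `η`
  have hG := twisted_graph_stability_eps (B := ↥T) (fun b => b.1.1) (fun b => b.1.1 + unitVec b.1.2) u hu
    (fun b => S b.1) (fun b => hS b.1 b.2) η hη0 hε0 (fun a t => by
      have h := hmin η hηout hη0 a t
      rw [← Finset.sum_coe_sort T] at h
      rw [← Finset.sum_coe_sort T] at h
      exact h)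
  rw [Finset.sum_coe_sort T (fun b => η b.1 * η (b.1 + unitVec b.2) *
      dotProduct (u b.1 - (S b)ᵀ *ᵥ u (b.1 + unitVec b.2)) (u b.1 - (S b)ᵀ *ᵥ u (b.1 + unitVec b.2)) *
        (2 - ε / 2 + dotProduct (u b.1 - (S b)ᵀ *ᵥ u (b.1 + unitVec b.2)) (u b.1 - (S b)ᵀ *ᵥ u (b.1 + unitVec b.2)))),
    Finset.sum_coe_sort T (fun b => 6 * dotProduct (u b.1) ((S b)ᵀ *ᵥ u (b.1 + unitVec b.2)) * (η b.1 - η (b.1 + unitVec b.2)) ^ 2 +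
        η b.1 * η (b.1 + unitVec b.2) * (4 * (4 - ∑ a : Fin 4, S b a a) +
          8 / ε * dotProduct (S b *ᵥ ((S b)ᵀ *ᵥ u (b.1 + unitVec b.2)) - (S b)ᵀ *ᵥ u (b.1 + unitVec b.2))
            (S b *ᵥ ((S b)ᵀ *ᵥ u (b.1 + unitVec b.2)) - (S b)ᵀ *ᵥ u (b.1 + unitVec b.2))))] at hG
  -- nonnegativity of bond energies
  have he0 : ∀ b : Zd 3 × Fin 3, 0 ≤ dotProduct (u b.1 - (S b)ᵀ *ᵥ u (b.1 + unitVec b.2)) (u b.1 - (S b)ᵀ *ᵥ u (b.1 + unitVec b.2)) :=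
    fun b => by
    simp only [dotProduct, Pi.sub_apply]
    exact Finset.sum_nonneg fun i _ => mul_self_nonneg _
  -- (i) LEFT: `(2 − ε∕2)·X ≤ LHS`, `X = Σ_k (r∕k − r∕(k+1))·E_k`
  have hX_le : ∑ k ∈ Finset.Ico r M, ((r : ℝ) / k - (r : ℝ) / (k + 1)) *
      ∑ b ∈ T.filter (fun b => b.1 ∈ box z (k : ℤ) ∧ b.1 + unitVec b.2 ∈ box z (k : ℤ)),
        dotProduct (u b.1 - (S b)ᵀ *ᵥ u (b.1 + unitVec b.2)) (u b.1 - (S b)ᵀ *ᵥ u (b.1 + unitVec b.2)) ≤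
      ∑ b ∈ T, η b.1 * η (b.1 + unitVec b.2) *
        dotProduct (u b.1 - (S b)ᵀ *ᵥ u (b.1 + unitVec b.2)) (u b.1 - (S b)ᵀ *ᵥ u (b.1 + unitVec b.2)) :=
    sum_box_energy_le_sum_profile T z hN hf0 hanti hsq _ he0
  have hL : (2 - ε / 2) * ∑ b ∈ T, η b.1 * η (b.1 + unitVec b.2) *
        dotProduct (u b.1 - (S b)ᵀ *ᵥ u (b.1 + unitVec b.2)) (u b.1 - (S b)ᵀ *ᵥ u (b.1 + unitVec b.2)) ≤
      ∑ b ∈ T, η b.1 * η (b.1 + unitVec b.2) *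
        dotProduct (u b.1 - (S b)ᵀ *ᵥ u (b.1 + unitVec b.2)) (u b.1 - (S b)ᵀ *ᵥ u (b.1 + unitVec b.2)) *
          (2 - ε / 2 + dotProduct (u b.1 - (S b)ᵀ *ᵥ u (b.1 + unitVec b.2)) (u b.1 - (S b)ᵀ *ᵥ u (b.1 + unitVec b.2))) := by
    rw [Finset.mul_sum]
    refine Finset.sum_le_sum fun b _ => ?_
    have h1 : 0 ≤ η b.1 * η (b.1 + unitVec b.2) *
        dotProduct (u b.1 - (S b)ᵀ *ᵥ u (b.1 + unitVec b.2)) (u b.1 - (S b)ᵀ *ᵥ u (b.1 + unitVec b.2)) :=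
      mul_nonneg (mul_nonneg (hη0 _) (hη0 _)) (he0 b)
    nlinarith [he0 b]
  -- (ii) RIGHT, gradient part: `c_b ≤ 1`, then only bonds issuing from `Q_{2M}(z)` count, then the capacity
  have hgrad : ∑ b ∈ T, 6 * dotProduct (u b.1) ((S b)ᵀ *ᵥ u (b.1 + unitVec b.2)) * (η b.1 - η (b.1 + unitVec b.2)) ^ 2 ≤
      36 * (r : ℝ) * (∑ k ∈ Finset.Ico r M, 1 / ((k : ℝ) + 1)) + 648 * r := by
    have h1 : ∑ b ∈ T, 6 * dotProduct (u b.1) ((S b)ᵀ *ᵥ u (b.1 + unitVec b.2)) * (η b.1 - η (b.1 + unitVec b.2)) ^ 2 ≤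
        ∑ b ∈ T, 6 * (η b.1 - η (b.1 + unitVec b.2)) ^ 2 := by
      refine Finset.sum_le_sum fun b hb => ?_
      have hc1 : dotProduct (u b.1) ((S b)ᵀ *ᵥ u (b.1 + unitVec b.2)) ≤ 1 :=
        dot_le_one (hu b.1) (by rw [transpose_mulVec_dot (hS b hb), hu])
      nlinarith [sq_nonneg (η b.1 - η (b.1 + unitVec b.2))]
    have h2 : ∑ b ∈ T, 6 * (η b.1 - η (b.1 + unitVec b.2)) ^ 2 ≤
        ∑ b ∈ (box z (2 * (M : ℤ))) ×ˢ (Finset.univ : Finset (Fin 3)), 6 * (η b.1 - η (b.1 + unitVec b.2)) ^ 2 := by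
      rw [← Finset.sum_filter_add_sum_filter_not T (fun b => b.1 ∈ box z (2 * (M : ℤ)))]
      have hz : ∑ b ∈ T.filter (fun b => ¬ b.1 ∈ box z (2 * (M : ℤ))), 6 * (η b.1 - η (b.1 + unitVec b.2)) ^ 2 = 0 := by
        refine Finset.sum_eq_zero fun b hb => ?_
        rw [Finset.mem_filter] at hb
        have hs := hNout b.1 hb.2
        have ht := (supIndex_step hN b.1 b.2).2
        simp only [hη]
        rw [hzero _ (by omega), hzero _ (by omega), sub_self, zero_pow two_ne_zero, mul_zero]
      rw [hz, add_zero]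
      refine Finset.sum_le_sum_of_subset_of_nonneg ?_ fun b _ _ => by positivity
      intro b hb
      rw [Finset.mem_filter] at hb
      exact Finset.mem_product.2 ⟨hb.2, Finset.mem_univ _⟩
    have h3 := sum_sq_sub_profile_le z hN hr hrM.le hzero hone hlogInc htapInc
    have h4 : ∑ b ∈ (box z (2 * (M : ℤ))) ×ˢ (Finset.univ : Finset (Fin 3)), 6 * (η b.1 - η (b.1 + unitVec b.2)) ^ 2 =
        6 * ∑ b ∈ (box z (2 * (M : ℤ))) ×ˢ (Finset.univ : Finset (Fin 3)), (f (N b.1) - f (N (b.1 + unitVec b.2))) ^ 2 := by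
      rw [Finset.mul_sum]
    rw [h4] at h2
    nlinarith [h1, h2, h3]
  -- (iii) RIGHT, twist part: `4(4 − tr S) + (8∕ε)|Sq − q|² ≤ (2 + 8∕ε)‖S − 1‖_F²`, `ηη ≤ 1`, only bonds issuing from `Q_{2M}(z)`
  have htwist : ∑ b ∈ T, η b.1 * η (b.1 + unitVec b.2) * (4 * (4 - ∑ a : Fin 4, S b a a) +
        8 / ε * dotProduct (S b *ᵥ ((S b)ᵀ *ᵥ u (b.1 + unitVec b.2)) - (S b)ᵀ *ᵥ u (b.1 + unitVec b.2))
          (S b *ᵥ ((S b)ᵀ *ᵥ u (b.1 + unitVec b.2)) - (S b)ᵀ *ᵥ u (b.1 + unitVec b.2))) ≤ (2 + 8 / ε) * r := by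
    have hF0 : ∀ b : Zd 3 × Fin 3, 0 ≤ ∑ a : Fin 4, ∑ i : Fin 4, (S b a i - (1 : Matrix (Fin 4) (Fin 4) ℝ) a i) ^ 2 := fun b =>
      Finset.sum_nonneg fun a _ => Finset.sum_nonneg fun i _ => sq_nonneg _
    have hper : ∀ b ∈ T, η b.1 * η (b.1 + unitVec b.2) * (4 * (4 - ∑ a : Fin 4, S b a a) +
        8 / ε * dotProduct (S b *ᵥ ((S b)ᵀ *ᵥ u (b.1 + unitVec b.2)) - (S b)ᵀ *ᵥ u (b.1 + unitVec b.2))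
          (S b *ᵥ ((S b)ᵀ *ᵥ u (b.1 + unitVec b.2)) - (S b)ᵀ *ᵥ u (b.1 + unitVec b.2))) ≤
        (if b.1 ∈ box z (2 * (M : ℤ)) then (2 + 8 / ε) * ∑ a : Fin 4, ∑ i : Fin 4, (S b a i - (1 : Matrix (Fin 4) (Fin 4) ℝ) a i) ^ 2
          else 0) := by
      intro b hb
      have htr := four_sub_trace_eq_half_frob (hS b hb)
      have hq : dotProduct ((S b)ᵀ *ᵥ u (b.1 + unitVec b.2)) ((S b)ᵀ *ᵥ u (b.1 + unitVec b.2)) = 1 := by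
        rw [transpose_mulVec_dot (hS b hb), hu]
      have hdev := normSq_mulVec_sub_le_frob (S b) ((S b)ᵀ *ᵥ u (b.1 + unitVec b.2))
      rw [hq, mul_one] at hdev
      have hbr : 4 * (4 - ∑ a : Fin 4, S b a a) +
          8 / ε * dotProduct (S b *ᵥ ((S b)ᵀ *ᵥ u (b.1 + unitVec b.2)) - (S b)ᵀ *ᵥ u (b.1 + unitVec b.2))
            (S b *ᵥ ((S b)ᵀ *ᵥ u (b.1 + unitVec b.2)) - (S b)ᵀ *ᵥ u (b.1 + unitVec b.2)) ≤
          (2 + 8 / ε) * ∑ a : Fin 4, ∑ i : Fin 4, (S b a i - (1 : Matrix (Fin 4) (Fin 4) ℝ) a i) ^ 2 := by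
        rw [htr, add_mul]
        have h8 : 0 ≤ 8 / ε := by positivity
        nlinarith [mul_le_mul_of_nonneg_left hdev h8]
      have hηη0 : 0 ≤ η b.1 * η (b.1 + unitVec b.2) := mul_nonneg (hη0 _) (hη0 _)
      have hηη1 : η b.1 * η (b.1 + unitVec b.2) ≤ 1 := by
        calc η b.1 * η (b.1 + unitVec b.2) ≤ 1 * 1 := mul_le_mul (hη1 _) (hη1 _) (hη0 _) zero_le_one
          _ = 1 := one_mul 1
      split_ifs with hin
      · calc _ ≤ η b.1 * η (b.1 + unitVec b.2) * ((2 + 8 / ε) * ∑ a : Fin 4, ∑ i : Fin 4, (S b a i - (1 : Matrix (Fin 4) (Fin 4) ℝ) a i) ^ 2) :=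
              mul_le_mul_of_nonneg_left hbr hηη0
          _ ≤ 1 * ((2 + 8 / ε) * ∑ a : Fin 4, ∑ i : Fin 4, (S b a i - (1 : Matrix (Fin 4) (Fin 4) ℝ) a i) ^ 2) :=
              mul_le_mul_of_nonneg_right hηη1 (mul_nonneg (by positivity) (hF0 b))
          _ = _ := one_mul _
      · rw [hηout _ hin, zero_mul, zero_mul]
    calc _ ≤ ∑ b ∈ T, (if b.1 ∈ box z (2 * (M : ℤ)) then
            (2 + 8 / ε) * ∑ a : Fin 4, ∑ i : Fin 4, (S b a i - (1 : Matrix (Fin 4) (Fin 4) ℝ) a i) ^ 2 else 0) :=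
          Finset.sum_le_sum hper
      _ = (2 + 8 / ε) * ∑ b ∈ T.filter (fun b => b.1 ∈ box z (2 * (M : ℤ))),
            ∑ a : Fin 4, ∑ i : Fin 4, (S b a i - (1 : Matrix (Fin 4) (Fin 4) ℝ) a i) ^ 2 := by
          rw [← Finset.sum_filter, Finset.mul_sum]
      _ ≤ (2 + 8 / ε) * r := mul_le_mul_of_nonneg_left hF (by positivity)
  -- (iv) the contradiction
  by_contra hcon
  push Not at hcon
  have hne : (Finset.Ico r M).Nonempty := Finset.nonempty_Ico.2 hrM
  have hX : c * r * ∑ k ∈ Finset.Ico r M, 1 / ((k : ℝ) + 1) <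
      ∑ k ∈ Finset.Ico r M, ((r : ℝ) / k - (r : ℝ) / (k + 1)) *
        ∑ b ∈ T.filter (fun b => b.1 ∈ box z (k : ℤ) ∧ b.1 + unitVec b.2 ∈ box z (k : ℤ)),
          dotProduct (u b.1 - (S b)ᵀ *ᵥ u (b.1 + unitVec b.2)) (u b.1 - (S b)ᵀ *ᵥ u (b.1 + unitVec b.2)) := by
    rw [Finset.mul_sum]
    refine Finset.sum_lt_sum_of_nonempty hne fun k hk => ?_
    rw [Finset.mem_Ico] at hk
    have hk0 : (0 : ℝ) < k := by exact_mod_cast (lt_of_lt_of_le hr hk.1)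
    have hlt := hcon k hk.1 hk.2
    have hw : (r : ℝ) / k - (r : ℝ) / (k + 1) = r / ((k : ℝ) * (k + 1)) := by field_simp; ring
    have hw0 : 0 < (r : ℝ) / k - (r : ℝ) / (k + 1) := by rw [hw]; positivity
    calc c * r * (1 / ((k : ℝ) + 1)) = ((r : ℝ) / k - (r : ℝ) / (k + 1)) * (c * k) := by rw [hw]; field_simp
      _ < _ := mul_lt_mul_of_pos_left hlt hw0
  have hH := le_harmonic_of_window hH₀0 hr hM
  have hmain : (2 - ε / 2) * ∑ k ∈ Finset.Ico r M, ((r : ℝ) / k - (r : ℝ) / (k + 1)) *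
      ∑ b ∈ T.filter (fun b => b.1 ∈ box z (k : ℤ) ∧ b.1 + unitVec b.2 ∈ box z (k : ℤ)),
        dotProduct (u b.1 - (S b)ᵀ *ᵥ u (b.1 + unitVec b.2)) (u b.1 - (S b)ᵀ *ᵥ u (b.1 + unitVec b.2)) ≤
      (∑ b ∈ T, 6 * dotProduct (u b.1) ((S b)ᵀ *ᵥ u (b.1 + unitVec b.2)) * (η b.1 - η (b.1 + unitVec b.2)) ^ 2) +
      ∑ b ∈ T, η b.1 * η (b.1 + unitVec b.2) * (4 * (4 - ∑ a : Fin 4, S b a a) +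
        8 / ε * dotProduct (S b *ᵥ ((S b)ᵀ *ᵥ u (b.1 + unitVec b.2)) - (S b)ᵀ *ᵥ u (b.1 + unitVec b.2))
          (S b *ᵥ ((S b)ᵀ *ᵥ u (b.1 + unitVec b.2)) - (S b)ᵀ *ᵥ u (b.1 + unitVec b.2))) := by
    rw [← Finset.sum_add_distrib]
    exact le_trans (le_trans (mul_le_mul_of_nonneg_left hX_le hκ0) hL) hG
  have hlt := cap_arith hc hκ hr0 hX hmain hgrad htwist
  exact absurd hH (not_le.2 hlt)

end Summit.QuantumFields.YangMills.Theorems.PoincareLipschitzLogCutoffStabilityCap
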